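import Literature.MathematicalPhysics.QuantumLattice.TorusSectorPressureTypeBoundAllTori
import HarnessLib

/-!
# The type-class (C2) pressure floor on a FILLING INTERVAL: two certified types at densities `ρ₁ ≤ ρ₂` give the
# chord floor `(1−λ)W₁ + λW₂` at every density `n = (1−λ)ρ₁ + λρ₂` in between, on every torus

Family `hubbard` (topic `MathematicalPhysics/QuantumLattice`); continuation of `TorusSectorPressureTypeBoundAllTori`
(filling leg of BOX → WORD for the free-energy route of the `T > 0` certificate family, Hubbard material-oracle
programme). One set of certified open-box data `0 < z_s ≤ Re Z_β(H^open_{a×b}(t,t',U); s)` (`s ∈ S`) and TWO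
balanced base types `m₁` (`Σ m₁ = q₁`, `Σ m₁ a_s = Σ m₁ b_s = A₁`, density `ρ₁ = 2A₁/(q₁ab)`) and `m₂`
(`q₂`, `A₂`, `ρ₂ = 2A₂/(q₂ab) ≥ ρ₁`) with type values `W_i = (q_i log q_i − Σ m_i log m_i + Σ m_i log z_s)/(q_i a b)`:
for every `λ ∈ [0, 1]`, at the density `n = (1−λ)ρ₁ + λρ₂ < 2` the canonical sector pressure of EVERY large torus is
at least the chord value `(1−λ)W₁ + λW₂` up to an explicit `O(L) + O(log L)` defect
(`typeFreeEntropy_chord_mul_sq_sub_le_log_partitionFn`), hence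
`∀ ε > 0, ∀ᶠ j, ((1−λ)W₁ + λW₂ − ε)(Ls j)² ≤ log Re Z_β(sectorHamiltonianTT' t t' U n (Ls j))` along ANY `Ls → ∞`
(`InfVolFermionState.eventually_typeFreeEntropy_chord_mul_sq_le_log_partitionFn_allTori`) — the pressure-floor
input of the `T > 0` readers at EVERY filling of the interval `[ρ₁, ρ₂]` from the same two certified types (no
re-certification per density; the interpolation is the mixture of `R₁` copies of type 1 and `R₂` copies of type 2
on ONE block grid, `(P^{N₁})(c₁)·(P^{N₂})(c₂) ≤ (P^{N₁+N₂})(c₁+c₂)` for the generating polynomial `P` of the data).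

* §1 `mul_coeff_le_coeff_mul` — superadditivity of nonnegative coefficients in `ℝ[ℕ × ℕ]`;
  `typeEntropy_sub_le_log_multinomial₀` — the method of types including the empty type.
* §2 `typeFreeEntropy_chord_mul_sq_sub_le_log_partitionFn` — finite volume, every `L ≥ q₁q₂a + 1`, `L ≥ b + 1`
  with `(A₂q₁ − A₁q₂) ≤ (1 − n/2)·L`:
  `W(λ)·L² − (|W(λ)| + βU⁺)(q₁q₂a + b)·L − (|W₁| + |W₂|)·q₁q₂ab − 2|S|·log(L²+1) ≤ log Re Z_β(sectorHamiltonianTT' t t' U n L)`.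
* §3 the thermodynamic limit along every `Ls → ∞`.

Everything is PROVED; no definition, no named fact.

## References

* D. Ruelle, *Statistical Mechanics: Rigorous Results* (1969), §3.3 eqs. (3.11)–(3.18), §3.4.3 (mixtures of two
  particle numbers in sub-boxes; convexity of the free energy in the density). [cite: Ruelle1969, §3.3 (3.11)–(3.18)]
* R. B. Israel, *Convexity in the Theory of Lattice Gases* (1979), Lemma II.3.1. [cite: Israel1979, Lemma II.3.1]
* T. M. Cover, J. A. Thomas, *Elements of Information Theory* (2006), Thm. 11.1.3. [cite: CoverThomas2006, Theorem 11.1.3]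
* J. P. F. LeBlanc et al., Phys. Rev. X 5 (2015) 041041, eq. (1). [cite: LeBlancEtAl2015, eq. (1)]
-/

noncomputable section

namespace Literature.MathematicalPhysics.QuantumLattice

open Matrix Finset HubbardWave0 ThermodynamicLimit LiebThm1 AddMonoidAlgebra Literature.Probability.LatticeModels
open _root_.Filter
open scoped _root_.Topology ComplexOrder BigOperators

/-! ### §1 Superadditivity of nonnegative coefficients; the method of types with the empty type -/

section Algebra

/-- **Superadditivity of nonnegative coefficients**: for `x, y ∈ ℝ[ℕ × ℕ]` with nonnegative coefficients,
`x(A₁,B₁) · y(A₂,B₂) ≤ (x·y)(A₁+A₂, B₁+B₂)` (one term of the convolution). [cite: Ruelle1969, §3.3 (3.11)–(3.18)] -/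
theorem mul_coeff_le_coeff_mul {x y : AddMonoidAlgebra ℝ (ℕ × ℕ)} (hx : ∀ m, 0 ≤ x.coeff m)
    (hy : ∀ m, 0 ≤ y.coeff m) (A₁ B₁ A₂ B₂ : ℕ) :
    x.coeff (A₁, B₁) * y.coeff (A₂, B₂) ≤ (x * y).coeff (A₁ + A₂, B₁ + B₂) := by
  rw [coeff_mul_eq_sum_splits]
  have hmem : (A₂, B₂) ∈ Finset.range (A₁ + A₂ + 1) ×ˢ Finset.range (B₁ + B₂ + 1) :=
    Finset.mem_product.2 ⟨Finset.mem_range.2 (by omega), Finset.mem_range.2 (by omega)⟩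
  have h := Finset.single_le_sum (f := fun q : ℕ × ℕ => x.coeff (A₁ + A₂ - q.1, B₁ + B₂ - q.2) * y.coeff q)
    (fun q _ => mul_nonneg (hx _) (hy _)) hmem
  simp only [Nat.add_sub_cancel] at h
  exact h

/-- **The method of types, logarithmic form, including the empty type**: for a type `k` of size `K` on `S`
(any `K`, also `K = 0`), `K log K − Σ_s k_s log k_s − |S| log(K+1) ≤ log multinomial(k)`.
[cite: CoverThomas2006, Theorem 11.1.3] -/
theorem typeEntropy_sub_le_log_multinomial₀ {σ : Type*} [DecidableEq σ] (S : Finset σ) {K : ℕ} {k : σ → ℕ}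
    (hk : k ∈ S.piAntidiag K) :
    (K : ℝ) * Real.log K - ∑ s ∈ S, (k s : ℝ) * Real.log (k s) - S.card * Real.log (K + 1) ≤
      Real.log (Nat.multinomial S k) := by
  rcases Nat.eq_zero_or_pos K with hK | hK
  · subst hK
    have hk0 : ∀ s ∈ S, k s = 0 := fun s hs =>
      (Finset.sum_eq_zero_iff.1 (Finset.mem_piAntidiag.1 hk).1) s hs
    have hs0 : ∑ s ∈ S, (k s : ℝ) * Real.log (k s) = 0 :=
      Finset.sum_eq_zero fun s hs => by rw [hk0 s hs]; simp
    rw [hs0]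
    have h1 : (1 : ℝ) ≤ Nat.multinomial S k := by exact_mod_cast Nat.multinomial_pos S k
    have h2 : 0 ≤ Real.log (Nat.multinomial S k : ℝ) := Real.log_nonneg h1
    simp only [Nat.cast_zero, Real.log_zero, mul_zero, sub_zero, zero_add, Real.log_one]
    linarith
  · exact typeEntropy_sub_le_log_multinomial S hK hk

/-- **The type term of the certified data, logarithmic form.** For the generating polynomial
`P = Σ_{s∈S} z_s X^s` of positive data `z` on `S` and a balanced base type `m` supported in `S` (`Σ m = q`,
`Σ m_s a_s = Σ m_s b_s = A`) taken `R` times (`R q = N`): the coefficient `(P^N)(RA, RA)` is positive and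
`R (q log q − Σ m log m) + R Σ m log z − |S| log(N + 1) ≤ log (P^N)(RA, RA)` (multinomial theorem + method of
types; `R = 0` allowed). [cite: CoverThomas2006, Theorem 11.1.3] [cite: Ruelle1969, §3.3 (3.11)–(3.18)] -/
theorem typeFreeEntropy_le_log_coeff_pow (S : Finset (ℕ × ℕ)) (m : ℕ × ℕ → ℕ) {q A R N : ℕ}
    (hmS : ∀ s, m s ≠ 0 → s ∈ S) (hsum : ∑ s ∈ S, m s = q) (hA : ∑ s ∈ S, m s * s.1 = A)
    (hB : ∑ s ∈ S, m s * s.2 = A) (hN : R * q = N) {z : ℕ × ℕ → ℝ} (hz0 : ∀ s ∈ S, 0 < z s) :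
    0 < ((∑ s ∈ S, single s (z s)) ^ N).coeff (R * A, R * A) ∧
      (R : ℝ) * ((q : ℝ) * Real.log q - ∑ s ∈ S, (m s : ℝ) * Real.log (m s)) +
          (R : ℝ) * ∑ s ∈ S, (m s : ℝ) * Real.log (z s) - S.card * Real.log ((N : ℝ) + 1) ≤
        Real.log (((∑ s ∈ S, single s (z s)) ^ N).coeff (R * A, R * A)) := by
  classical
  have hk : (fun s => R * m s) ∈ S.piAntidiag N := by
    rw [Finset.mem_piAntidiag]
    refine ⟨?_, fun s hs => hmS s (fun h0 => hs (by rw [h0, mul_zero]))⟩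
    rw [← Finset.mul_sum, hsum, hN]
  have htarget : (∑ s ∈ S, (R * m s) • (s : ℕ × ℕ)) = (R * A, R * A) := by
    refine Prod.ext ?_ ?_
    · rw [Prod.fst_sum]
      show ∑ s ∈ S, ((R * m s) • s).1 = R * A
      simp_rw [Prod.smul_fst, smul_eq_mul]
      rw [← hA, Finset.mul_sum]
      exact Finset.sum_congr rfl fun s _ => by ring
    · rw [Prod.snd_sum]
      show ∑ s ∈ S, ((R * m s) • s).2 = R * A
      simp_rw [Prod.smul_snd, smul_eq_mul]
      rw [← hB, Finset.mul_sum]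
      exact Finset.sum_congr rfl fun s _ => by ring
  have hcoeff := le_coeff_pow_of_type S (fun s => s) z (fun s hs => (hz0 s hs).le) hk
  rw [htarget] at hcoeff
  have hmult : (0 : ℝ) < Nat.multinomial S (fun s => R * m s) := by exact_mod_cast Nat.multinomial_pos S _
  have hprod : (0 : ℝ) < ∏ s ∈ S, z s ^ (R * m s) := Finset.prod_pos fun s hs => pow_pos (hz0 s hs) _
  refine ⟨lt_of_lt_of_le (mul_pos hmult hprod) hcoeff, ?_⟩
  have hlog := Real.log_le_log (mul_pos hmult hprod) hcoeff
  rw [Real.log_mul hmult.ne' hprod.ne', Real.log_prod (fun s hs => (pow_pos (hz0 s hs) _).ne')] at hlog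
  rw [Finset.sum_congr rfl fun s _ => Real.log_pow _ _] at hlog
  have htype := typeEntropy_sub_le_log_multinomial₀ S hk
  rw [← hN, InfVolFermionState.typeEntropy_smul S m hsum R] at htype
  have hzsum : ∑ s ∈ S, ((R * m s : ℕ) : ℝ) * Real.log (z s) = (R : ℝ) * ∑ s ∈ S, (m s : ℝ) * Real.log (z s) := by
    rw [Finset.mul_sum]; exact Finset.sum_congr rfl fun s _ => by push_cast; ring
  rw [hzsum] at hlog
  have hcast : (((R * q : ℕ) : ℝ) + 1) = ((N : ℝ) + 1) := by rw [hN]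
  rw [hcast] at htype
  linarith

/-- The chord defect: `−(|W₁| + |W₂|)·c ≤ c·δ·(W₁ − W₂)` for `c ≥ 0`, `δ ∈ [0, 1]`. [folklore] -/
private theorem neg_abs_add_abs_mul_le (W₁ W₂ c δ : ℝ) (hc : 0 ≤ c) (hδ0 : 0 ≤ δ) (hδ1 : δ ≤ 1) :
    -((|W₁| + |W₂|) * c) ≤ c * δ * (W₁ - W₂) := by
  have hd : |W₁ - W₂| ≤ |W₁| + |W₂| := abs_sub _ _
  have h2 : |c * δ * (W₁ - W₂)| ≤ (|W₁| + |W₂|) * c := by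
    rw [abs_mul, abs_mul, abs_of_nonneg hc, abs_of_nonneg hδ0]
    calc c * δ * |W₁ - W₂| ≤ c * 1 * (|W₁| + |W₂|) :=
          mul_le_mul (mul_le_mul_of_nonneg_left hδ1 hc) hd (abs_nonneg _) (by positivity)
      _ = (|W₁| + |W₂|) * c := by ring
  linarith [neg_abs_le (c * δ * (W₁ - W₂))]

end Algebra

/-! ### §2 Every large torus: the chord of two types, finite volume -/

section Chord

/-- **The chord floor of two certified types on EVERY large torus, finite volume.** Data: open `a × b` box
(`a, b ≥ 1`), sectors `S`, floors `0 < z_s ≤ Re Z_β(H^open_{a×b}(t,t',U); s)` (`β ≥ 0`), two balanced base types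
`m₁, m₂` supported in `S` (`Σ m_i = q_i ≥ 1`, `Σ m_i a_s = Σ m_i b_s = A_i`) with `A₁ q₂ ≤ A₂ q₁` (densities
`ρ₁ ≤ ρ₂`, `ρ_i = 2A_i/(q_i a b)`), `λ ∈ [0, 1]`, and the interpolated density
`n q₁ q₂ a b = 2((1−λ) A₁ q₂ + λ A₂ q₁)` (i.e. `n = (1−λ)ρ₁ + λρ₂`), `n < 2`. For every `L ≥ q₁q₂a + 1`, `L ≥ b + 1`
with `A₂q₁ − A₁q₂ ≤ (1 − n/2)·L`, writing `W_i = (q_i log q_i − Σ m_i log m_i + Σ m_i log z_s)/(q_i a b)` and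
`W = (1−λ)W₁ + λW₂`:
`W·L² − (|W| + βU⁺)(q₁q₂a + b)·L − (|W₁| + |W₂|)·(q₁q₂ab) − 2|S|·log(L²+1) ≤ log Re Z_β(sectorHamiltonianTT' t t' U n L)`.
Construction: ONE inner block grid (`K_x = q₁q₂⌊(L−1)/(q₁q₂a)⌋` rows of blocks, `K_y = ⌊(L−1)/b⌋` columns) carrying
`R₁` copies of type 1 and `R₂` copies of type 2 (`R₂ q₂ = q₁q₂⌊λ K_xK_y/(q₁q₂)⌋`), the type parts multiplied inside one
coefficient of the generating polynomial (`mul_coeff_le_coeff_mul`); the rounding surplus `≤ A₂q₁ − A₁q₂` electrons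
and the density share of the `O(L)` border go to the border strips at the crude floor.
[cite: Ruelle1969, §3.3 (3.11)–(3.18)] [cite: Israel1979, Lemma II.3.1] [cite: CoverThomas2006, Theorem 11.1.3] -/
theorem typeFreeEntropy_chord_mul_sq_sub_le_log_partitionFn (t t' U n : ℝ) {β : ℝ} (hβ : 0 ≤ β)
    {a b : ℕ} (ha : 1 ≤ a) (hb : 1 ≤ b) (S : Finset (ℕ × ℕ)) (m₁ m₂ : ℕ × ℕ → ℕ) {q₁ q₂ A₁ A₂ : ℕ}
    (hq₁ : 1 ≤ q₁) (hq₂ : 1 ≤ q₂) (hm₁S : ∀ s, m₁ s ≠ 0 → s ∈ S) (hm₂S : ∀ s, m₂ s ≠ 0 → s ∈ S)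
    (hsum₁ : ∑ s ∈ S, m₁ s = q₁) (hsum₂ : ∑ s ∈ S, m₂ s = q₂)
    (hA₁ : ∑ s ∈ S, m₁ s * s.1 = A₁) (hB₁ : ∑ s ∈ S, m₁ s * s.2 = A₁)
    (hA₂ : ∑ s ∈ S, m₂ s * s.1 = A₂) (hB₂ : ∑ s ∈ S, m₂ s * s.2 = A₂) (hρ : A₁ * q₂ ≤ A₂ * q₁)
    {lam : ℝ} (hlam0 : 0 ≤ lam) (hlam1 : lam ≤ 1)
    (hn : n * ((q₁ : ℝ) * q₂ * a * b) = 2 * ((1 - lam) * A₁ * q₂ + lam * A₂ * q₁)) (hn2 : n < 2)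
    {z : ℕ × ℕ → ℝ} (hz0 : ∀ s ∈ S, 0 < z s)
    (hz : ∀ s ∈ S, z s ≤ (partitionFn β (spinSectorHamiltonian s.1 s.2 (hubbardOpenBoxTT' a b t t' U))).re)
    {L : ℕ} (hLa : q₁ * q₂ * a + 1 ≤ L) (hLb : b + 1 ≤ L)
    (hLn : ((A₂ * q₁ - A₁ * q₂ : ℕ) : ℝ) ≤ (1 - n / 2) * L) :
    ((1 - lam) * (((q₁ : ℝ) * Real.log q₁ - ∑ s ∈ S, (m₁ s : ℝ) * Real.log (m₁ s) +
          ∑ s ∈ S, (m₁ s : ℝ) * Real.log (z s)) / ((q₁ : ℝ) * a * b)) +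
        lam * (((q₂ : ℝ) * Real.log q₂ - ∑ s ∈ S, (m₂ s : ℝ) * Real.log (m₂ s) +
          ∑ s ∈ S, (m₂ s : ℝ) * Real.log (z s)) / ((q₂ : ℝ) * a * b))) * (L : ℝ) ^ 2 -
        (|(1 - lam) * (((q₁ : ℝ) * Real.log q₁ - ∑ s ∈ S, (m₁ s : ℝ) * Real.log (m₁ s) +
            ∑ s ∈ S, (m₁ s : ℝ) * Real.log (z s)) / ((q₁ : ℝ) * a * b)) +
          lam * (((q₂ : ℝ) * Real.log q₂ - ∑ s ∈ S, (m₂ s : ℝ) * Real.log (m₂ s) +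
            ∑ s ∈ S, (m₂ s : ℝ) * Real.log (z s)) / ((q₂ : ℝ) * a * b))| + β * max U 0) *
          ((q₁ * q₂ * a + b : ℕ) : ℝ) * L -
        (|((q₁ : ℝ) * Real.log q₁ - ∑ s ∈ S, (m₁ s : ℝ) * Real.log (m₁ s) +
            ∑ s ∈ S, (m₁ s : ℝ) * Real.log (z s)) / ((q₁ : ℝ) * a * b)| +
          |((q₂ : ℝ) * Real.log q₂ - ∑ s ∈ S, (m₂ s : ℝ) * Real.log (m₂ s) +
            ∑ s ∈ S, (m₂ s : ℝ) * Real.log (z s)) / ((q₂ : ℝ) * a * b)|) * ((q₁ * q₂ * a * b : ℕ) : ℝ) -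
        2 * S.card * Real.log ((L : ℝ) ^ 2 + 1) ≤
      Real.log (partitionFn β (sectorHamiltonianTT' t t' U n L)).re := by
  classical
  /- 1. integer geometry (nonlinear integer terms are named, so that `omega` sees atoms) -/
  have hq₁0 : 0 < q₁ := hq₁
  have hq₂0 : 0 < q₂ := hq₂
  obtain ⟨Q, hQ⟩ : ∃ Q', Q' = q₁ * q₂ := ⟨_, rfl⟩
  have hQ1 : 1 ≤ Q := by rw [hQ]; exact Nat.mul_pos hq₁0 hq₂0
  have hQa : 0 < Q * a := Nat.mul_pos hQ1 ha
  obtain ⟨Kx', hKx'⟩ : ∃ K, K = (L - 1) / (Q * a) := ⟨_, rfl⟩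
  obtain ⟨Ky, hKy⟩ : ∃ K, K = (L - 1) / b := ⟨_, rfl⟩
  obtain ⟨QA, hQA⟩ : ∃ Q', Q' = Q * a := ⟨_, rfl⟩
  obtain ⟨M₁, hM₁⟩ : ∃ M, M = (L - 1) % (Q * a) := ⟨_, rfl⟩
  obtain ⟨M₂, hM₂⟩ : ∃ M, M = (L - 1) % b := ⟨_, rfl⟩
  obtain ⟨K₁, hK₁⟩ : ∃ K, K = Q * Kx' * a := ⟨_, rfl⟩
  obtain ⟨K₂, hK₂⟩ : ∃ K, K = Ky * b := ⟨_, rfl⟩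
  have hLa' : Q * a + 1 ≤ L := by rw [hQ]; exact hLa
  have hdm1 : K₁ + M₁ = L - 1 := by
    rw [hK₁, hM₁, hKx', Nat.mul_right_comm]; exact Nat.div_add_mod (L - 1) (Q * a)
  have hm1 : M₁ < QA := by rw [hM₁, hQA]; exact Nat.mod_lt _ hQa
  have hdm2 : K₂ + M₂ = L - 1 := by
    rw [hK₂, hM₂, hKy, Nat.mul_comm]; exact Nat.div_add_mod (L - 1) b
  have hm2 : M₂ < b := by rw [hM₂]; exact Nat.mod_lt _ (by omega)
  have hQAL : QA + 1 ≤ L := by rw [hQA]; exact hLa'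
  have hKx'1 : 1 ≤ Kx' := by rw [hKx']; exact Nat.div_pos (by omega) hQa
  have hKy1 : 1 ≤ Ky := by rw [hKy]; exact Nat.div_pos (by omega) (by omega)
  clear hKx' hKy hM₁ hM₂
  obtain ⟨h, hh⟩ : ∃ h', h' = L - K₁ := ⟨_, rfl⟩
  obtain ⟨w, hw⟩ : ∃ w', w' = L - K₂ := ⟨_, rfl⟩
  have hh1 : 1 ≤ h := by omega
  have hhle : h ≤ QA := by omega
  have hw1 : 1 ≤ w := by omega
  have hwle : w ≤ b := by omega
  have e1 : K₁ + h = L := by omega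
  have e2 : K₂ + w = L := by omega
  clear hh hw hdm1 hm1 hdm2 hm2
  have hKx1 : 1 ≤ Q * Kx' := le_trans hQ1 (Nat.le_mul_of_pos_right Q hKx'1)
  -- real forms
  have e1R : (K₁ : ℝ) + h = L := by exact_mod_cast e1
  have e2R : (K₂ : ℝ) + w = L := by exact_mod_cast e2
  have hQR : (Q : ℝ) = q₁ * q₂ := by rw [hQ]; push_cast; ring
  have hK₁R : (K₁ : ℝ) = Q * Kx' * a := by rw [hK₁]; push_cast; ring
  have hK₂R : (K₂ : ℝ) = Ky * b := by rw [hK₂]; push_cast; ring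
  have hhR : (h : ℝ) ≤ Q * a := by
    have : (h : ℝ) ≤ QA := by exact_mod_cast hhle
    rw [hQA] at this; push_cast at this; exact this
  have hwR : (w : ℝ) ≤ b := by exact_mod_cast hwle
  have hh0 : (0 : ℝ) ≤ h := Nat.cast_nonneg h
  have hw0 : (0 : ℝ) ≤ w := Nat.cast_nonneg w
  have hK₁0 : (0 : ℝ) ≤ K₁ := Nat.cast_nonneg K₁
  have hK₂0 : (0 : ℝ) ≤ K₂ := Nat.cast_nonneg K₂
  have hL0 : (0 : ℝ) ≤ L := Nat.cast_nonneg L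
  have hh1R : (1 : ℝ) ≤ h := by exact_mod_cast hh1
  have hK₁L : (K₁ : ℝ) ≤ L := by linarith
  have hK₂L : (K₂ : ℝ) ≤ L := by linarith
  -- border identity and bounds
  have hborder : (L : ℝ) ^ 2 - K₁ * K₂ = w * K₁ + h * L := by
    linear_combination (-(L : ℝ)) * e1R + (-(K₁ : ℝ)) * e2R
  have hborder_le : (L : ℝ) ^ 2 - K₁ * K₂ ≤ ((q₁ * q₂ * a + b : ℕ) : ℝ) * L := by
    rw [hborder]; push_cast
    have h1 : (w : ℝ) * K₁ ≤ w * L := mul_le_mul_of_nonneg_left hK₁L hw0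
    have h2 : (w : ℝ) * L ≤ b * L := mul_le_mul_of_nonneg_right hwR hL0
    have h3 : (h : ℝ) * L ≤ Q * a * L := mul_le_mul_of_nonneg_right hhR hL0
    rw [hQR] at h3
    linarith
  have hborder_ge : (L : ℝ) ≤ (L : ℝ) ^ 2 - K₁ * K₂ := by
    rw [hborder]
    have h1 : (0 : ℝ) ≤ w * K₁ := mul_nonneg hw0 hK₁0
    have h2 : (L : ℝ) ≤ h * L := le_mul_of_one_le_left hL0 hh1R
    linarith
  have hK₁K₂le : (K₁ : ℝ) * K₂ ≤ (L : ℝ) ^ 2 := by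
    rw [sq]; exact mul_le_mul hK₁L hK₂L hK₂0 hL0
  have hbord0 : 0 ≤ (L : ℝ) ^ 2 - K₁ * K₂ := sub_nonneg.2 hK₁K₂le
  /- 2. the two types: `X + Y = Kx' Ky` blocks in units of `Q = q₁ q₂`, `Y = ⌊λ Kx' Ky⌋` of them of type 2 -/
  obtain ⟨N, hN⟩ : ∃ N', N' = Kx' * Ky := ⟨_, rfl⟩
  obtain ⟨Y, hY⟩ : ∃ Y', Y' = ⌊lam * (N : ℝ)⌋₊ := ⟨_, rfl⟩
  have hYle : Y ≤ N := by
    rw [hY]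
    calc ⌊lam * (N : ℝ)⌋₊ ≤ ⌊((N : ℕ) : ℝ)⌋₊ :=
          Nat.floor_le_floor (mul_le_of_le_one_left (Nat.cast_nonneg _) hlam1)
      _ = N := Nat.floor_natCast _
  obtain ⟨X, hX⟩ : ∃ X', X' = N - Y := ⟨_, rfl⟩
  have hXY : X + Y = N := by omega
  have hN0 : (0 : ℝ) ≤ lam * (N : ℝ) := mul_nonneg hlam0 (Nat.cast_nonneg _)
  have hδ0 : (Y : ℝ) ≤ lam * N := by rw [hY]; exact Nat.floor_le hN0
  have hδ1 : lam * (N : ℝ) < Y + 1 := by rw [hY]; exact Nat.lt_floor_add_one _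
  clear hY hX
  have hXYR : (X : ℝ) + Y = N := by exact_mod_cast hXY
  -- copies of the types: `R₁ = q₂ X`, `R₂ = q₁ Y`; block counts `N₁ = Q X`, `N₂ = Q Y`, `N₁ + N₂ = Kx Ky`
  obtain ⟨R₁, hR₁⟩ : ∃ R, R = q₂ * X := ⟨_, rfl⟩
  obtain ⟨R₂, hR₂⟩ : ∃ R, R = q₁ * Y := ⟨_, rfl⟩
  have hN₁ : R₁ * q₁ = Q * X := by rw [hR₁, hQ]; ring
  have hN₂ : R₂ * q₂ = Q * Y := by rw [hR₂, hQ]; ring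
  have hKK : Q * X + Q * Y = Q * Kx' * Ky := by rw [← Nat.mul_add, hXY, hN, Nat.mul_assoc]
  have hqabpos₁ : (0 : ℝ) < (q₁ : ℝ) * a * b := by
    have : (0 : ℝ) < q₁ := by exact_mod_cast hq₁0
    have : (0 : ℝ) < a := by exact_mod_cast ha
    have : (0 : ℝ) < b := by exact_mod_cast hb
    positivity
  have hqabpos₂ : (0 : ℝ) < (q₂ : ℝ) * a * b := by
    have : (0 : ℝ) < q₂ := by exact_mod_cast hq₂0
    have : (0 : ℝ) < a := by exact_mod_cast ha
    have : (0 : ℝ) < b := by exact_mod_cast hb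
    positivity
  have hq₁R : (0 : ℝ) < q₁ := by exact_mod_cast hq₁0
  have hq₂R : (0 : ℝ) < q₂ := by exact_mod_cast hq₂0
  have hA₁0 : (0 : ℝ) ≤ A₁ := Nat.cast_nonneg A₁
  have hA₂0 : (0 : ℝ) ≤ A₂ := Nat.cast_nonneg A₂
  have hρR : (A₁ : ℝ) * q₂ ≤ A₂ * q₁ := by exact_mod_cast hρ
  have hC₀R : ((A₂ * q₁ - A₁ * q₂ : ℕ) : ℝ) = (A₂ : ℝ) * q₁ - A₁ * q₂ := by
    rw [Nat.cast_sub (by simpa [mul_comm] using hρ)]; push_cast; ring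
  have hn0 : 0 ≤ n := by
    have hrhs : 0 ≤ 2 * ((1 - lam) * (A₁ : ℝ) * q₂ + lam * A₂ * q₁) := by
      have : 0 ≤ (1 - lam) := sub_nonneg.2 hlam1
      positivity
    have hQab : (0 : ℝ) < (q₁ : ℝ) * q₂ * a * b := by positivity
    exact le_of_mul_le_mul_right (by rw [zero_mul, hn]; exact hrhs) hQab
  -- the inner particle numbers (per spin); the target `(n/2) K₁ K₂ = M (X + Y)`; the rounding surplus
  obtain ⟨inner, hinner⟩ : ∃ i, i = R₁ * A₁ + R₂ * A₂ := ⟨_, rfl⟩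
  have hinnerR : (inner : ℝ) = q₂ * X * A₁ + q₁ * Y * A₂ := by rw [hinner, hR₁, hR₂]; push_cast; ring
  have hNR : (N : ℝ) = Kx' * Ky := by rw [hN]; push_cast; ring
  set M : ℝ := (1 - lam) * A₁ * q₂ + lam * A₂ * q₁ with hM
  have hK₁K₂ : (K₁ : ℝ) * K₂ = (q₁ : ℝ) * q₂ * a * b * (X + Y) := by
    rw [hK₁R, hK₂R, hQR, hXYR, hNR]; ring
  have htarget : n / 2 * ((K₁ : ℝ) * K₂) = M * (X + Y) := by
    rw [hK₁K₂]
    linear_combination ((X : ℝ) + Y) / 2 * hn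
  have hsurplus : M * ((X : ℝ) + Y) - inner = (lam * ((X : ℝ) + Y) - Y) * ((A₂ : ℝ) * q₁ - A₁ * q₂) := by
    rw [hinnerR, hM]; ring
  have hC₀0 : 0 ≤ (A₂ : ℝ) * q₁ - A₁ * q₂ := by linarith only [hρR]
  have hδ0' : 0 ≤ lam * ((X : ℝ) + Y) - Y := by rw [hXYR]; linarith only [hδ0]
  have hδ1' : lam * ((X : ℝ) + Y) - Y ≤ 1 := by rw [hXYR]; linarith only [hδ1]
  have hsur0 : 0 ≤ M * ((X : ℝ) + Y) - inner := by rw [hsurplus]; exact mul_nonneg hδ0' hC₀0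
  have hsur1 : M * ((X : ℝ) + Y) - inner ≤ (A₂ : ℝ) * q₁ - A₁ * q₂ := by
    rw [hsurplus]; exact le_trans (mul_le_mul_of_nonneg_right hδ1' hC₀0) (by rw [one_mul])
  -- the type parts fit below the canonical sector, the remainder fits into the border
  obtain ⟨kL, hkL⟩ : ∃ k, k = halfRectN n L := ⟨_, rfl⟩
  have hinnerle : inner ≤ kL := by
    rw [hkL]
    unfold halfRectN
    refine Nat.le_floor ?_
    have h1 := mul_le_mul_of_nonneg_left hK₁K₂le (by linarith only [hn0] : 0 ≤ n / 2)
    linarith only [h1, htarget, hsur0]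
  have hδk : (kL : ℝ) ≤ n * (L : ℝ) ^ 2 / 2 := by
    rw [hkL]; unfold halfRectN; exact Nat.floor_le (by positivity)
  obtain ⟨ρ, hρ'⟩ : ∃ ρ', ρ' = kL - inner := ⟨_, rfl⟩
  have hρsum : inner + ρ = kL := by omega
  have hρR : (ρ : ℝ) = (kL : ℝ) - inner := by
    have h1 : ((inner + ρ : ℕ) : ℝ) = (kL : ℝ) := congrArg (Nat.cast : ℕ → ℝ) hρsum
    rw [Nat.cast_add] at h1
    linarith only [h1]
  have hρle : (ρ : ℝ) ≤ (L : ℝ) ^ 2 - K₁ * K₂ := by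
    -- `ρ ≤ (n/2)(L² − K₁K₂) + C₀` and `C₀ ≤ (1 − n/2) L ≤ (1 − n/2)(L² − K₁K₂)`
    have h1 : (ρ : ℝ) ≤ n / 2 * ((L : ℝ) ^ 2 - K₁ * K₂) + ((A₂ : ℝ) * q₁ - A₁ * q₂) := by
      rw [hρR]; linarith only [htarget, hsur1, hδk]
    have h2 : (A₂ : ℝ) * q₁ - A₁ * q₂ ≤ (1 - n / 2) * ((L : ℝ) ^ 2 - K₁ * K₂) := by
      rw [← hC₀R]
      exact hLn.trans (mul_le_mul_of_nonneg_left hborder_ge (by linarith only [hn2]))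
    linarith only [h1, h2]
  have hρleN : ρ ≤ w * K₁ + h * L := by
    have : (ρ : ℝ) ≤ w * K₁ + h * L := hρle.trans (le_of_eq hborder)
    exact_mod_cast this
  obtain ⟨u, hu⟩ : ∃ u', u' = min ρ (w * K₁) := ⟨_, rfl⟩
  obtain ⟨v, hv⟩ : ∃ v', v' = ρ - u := ⟨_, rfl⟩
  have hule : u ≤ w * (Q * Kx' * a) := by rw [hu, ← hK₁]; exact min_le_right _ _
  have huρ : u ≤ ρ := by rw [hu]; exact min_le_left _ _
  have hvle : v ≤ h * (Ky * b + w) := by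
    rw [← hK₂, e2, hv]
    rcases le_total ρ (w * K₁) with hc | hc
    · rw [hu, min_eq_left hc, Nat.sub_self]; exact Nat.zero_le _
    · rw [hu, min_eq_right hc]; omega
  have hsec : inner + u + v = kL := by omega
  have hρuv : (u : ℝ) + v = ρ := by
    have h1 : u + v = ρ := by omega
    have h2 : ((u + v : ℕ) : ℝ) = (ρ : ℝ) := congrArg (Nat.cast : ℕ → ℝ) h1
    rwa [Nat.cast_add] at h2
  clear hρ' hv hu
  /- 3. the generating polynomial of the certified box data and the two type terms -/
  set P : AddMonoidAlgebra ℝ (ℕ × ℕ) := ∑ s ∈ S, single s (z s) with hPdef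
  have hPcoeff : ∀ c : ℕ × ℕ, P.coeff c = if c ∈ S then z c else 0 := by
    intro c
    rw [hPdef, coeff_sum, Finset.sum_apply']
    simp_rw [coeff_single, Finsupp.single_apply]
    rw [Finset.sum_ite_eq' S c]
  have hP0 : ∀ c, 0 ≤ P.coeff c := by
    intro c
    rw [hPcoeff]
    split_ifs with hc
    · exact (hz0 c hc).le
    · exact le_rfl
  have hPle : ∀ c d, P.coeff (c, d) ≤
      (partitionFn β (spinSectorHamiltonian c d (hubbardOpenBoxTT' a b t t' U))).re := by
    intro c d
    rw [hPcoeff]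
    split_ifs with hc
    · exact hz (c, d) hc
    · exact partitionFn_spinSector_re_nonneg _ _ (hubbardOpenBoxTT'_isHermitian a b t t' U) β
  obtain ⟨hc₁pos, hlogc₁⟩ := typeFreeEntropy_le_log_coeff_pow S m₁ hm₁S hsum₁ hA₁ hB₁ hN₁ hz0
  obtain ⟨hc₂pos, hlogc₂⟩ := typeFreeEntropy_le_log_coeff_pow S m₂ hm₂S hsum₂ hA₂ hB₂ hN₂ hz0
  rw [← hPdef] at hc₁pos hlogc₁ hc₂pos hlogc₂
  -- the two type parts inside ONE coefficient of `P ^ (Kx Ky)`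
  have hmulcoeff : (P ^ (Q * X)).coeff (R₁ * A₁, R₁ * A₁) * (P ^ (Q * Y)).coeff (R₂ * A₂, R₂ * A₂) ≤
      (P ^ (Q * Kx' * Ky)).coeff (inner, inner) := by
    rw [← hKK, pow_add, hinner]
    exact mul_coeff_le_coeff_mul (coeff_pow_nonneg_of_nonneg hP0 _) (coeff_pow_nonneg_of_nonneg hP0 _) _ _ _ _
  /- 4. the corner cut on the torus `L × L = (Q Kx' a + h) × (Ky b + w)` -/
  have hC := coeff_pow_mul_exp_le_partitionFn_rectTorus_corner a b (Q * Kx') Ky h w hKx1 hKy1 hh1 hw1 t t' U hβ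
    P hP0 hPle inner inner hule hule hvle hvle
  rw [min_self, min_self, hsec] at hC
  have hL1 : Q * Kx' * a + h = L := by rw [← hK₁]; exact e1
  have hL2 : Ky * b + w = L := by rw [← hK₂]; exact e2
  have hsq : Real.log (partitionFn β (spinSectorHamiltonian kL kL
      (hubbardRectTorusTT' (Q * Kx' * a + h) (Ky * b + w) t t' U))).re =
      Real.log (partitionFn β (sectorHamiltonianTT' t t' U n L)).re := by
    rw [partitionFn_sectorHamiltonianTT'_eq_spinSector, partitionFn_spinSector_hubbardTorusTT'_eq_rect, hL1, hL2,
      hkL]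
  have hLHS : (P ^ (Q * X)).coeff (R₁ * A₁, R₁ * A₁) * (P ^ (Q * Y)).coeff (R₂ * A₂, R₂ * A₂) *
      Real.exp (-(β * max U 0 * (u : ℝ))) * Real.exp (-(β * max U 0 * (v : ℝ))) ≤
      (partitionFn β (spinSectorHamiltonian kL kL (hubbardRectTorusTT' (Q * Kx' * a + h) (Ky * b + w) t t' U))).re :=
    le_trans (mul_le_mul_of_nonneg_right (mul_le_mul_of_nonneg_right hmulcoeff (Real.exp_pos _).le)
      (Real.exp_pos _).le) hC
  /- 5. logarithms -/
  have hLHSpos : 0 < (P ^ (Q * X)).coeff (R₁ * A₁, R₁ * A₁) * (P ^ (Q * Y)).coeff (R₂ * A₂, R₂ * A₂) *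
      Real.exp (-(β * max U 0 * (u : ℝ))) * Real.exp (-(β * max U 0 * (v : ℝ))) := by positivity
  have hlogZ := Real.log_le_log hLHSpos hLHS
  rw [Real.log_mul (by positivity) (Real.exp_pos _).ne', Real.log_mul (by positivity) (Real.exp_pos _).ne',
    Real.log_mul hc₁pos.ne' hc₂pos.ne', Real.log_exp, Real.log_exp, hsq] at hlogZ
  /- 6. bookkeeping -/
  set T₁ : ℝ := (q₁ : ℝ) * Real.log q₁ - ∑ s ∈ S, (m₁ s : ℝ) * Real.log (m₁ s) with hT₁
  set T₂ : ℝ := (q₂ : ℝ) * Real.log q₂ - ∑ s ∈ S, (m₂ s : ℝ) * Real.log (m₂ s) with hT₂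
  set Zs₁ : ℝ := ∑ s ∈ S, (m₁ s : ℝ) * Real.log (z s) with hZs₁
  set Zs₂ : ℝ := ∑ s ∈ S, (m₂ s : ℝ) * Real.log (z s) with hZs₂
  set W₁ : ℝ := (T₁ + Zs₁) / ((q₁ : ℝ) * a * b) with hW₁
  set W₂ : ℝ := (T₂ + Zs₂) / ((q₂ : ℝ) * a * b) with hW₂
  set W : ℝ := (1 - lam) * W₁ + lam * W₂ with hW
  have hR₁R : (R₁ : ℝ) = q₂ * X := by rw [hR₁]; push_cast; ring
  have hR₂R : (R₂ : ℝ) = q₁ * Y := by rw [hR₂]; push_cast; ring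
  -- `R_i (T_i + Zs_i) = W_i · q₁ q₂ a b · (X resp. Y)`
  have hWX : (R₁ : ℝ) * T₁ + (R₁ : ℝ) * Zs₁ = W₁ * ((q₁ : ℝ) * q₂ * a * b) * X := by
    rw [hW₁, hR₁R]; field_simp
  have hWY : (R₂ : ℝ) * T₂ + (R₂ : ℝ) * Zs₂ = W₂ * ((q₁ : ℝ) * q₂ * a * b) * Y := by
    rw [hW₂, hR₂R]; field_simp
  -- the chord: `W₁ Qab X + W₂ Qab Y ≥ W K₁K₂ − (|W₁| + |W₂|) Qab`
  have hQab0 : (0 : ℝ) ≤ (q₁ : ℝ) * q₂ * a * b := by positivity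
  have hchord : W * ((K₁ : ℝ) * K₂) - (|W₁| + |W₂|) * ((q₁ : ℝ) * q₂ * a * b) ≤
      W₁ * ((q₁ : ℝ) * q₂ * a * b) * X + W₂ * ((q₁ : ℝ) * q₂ * a * b) * Y := by
    have e : W₁ * ((q₁ : ℝ) * q₂ * a * b) * X + W₂ * ((q₁ : ℝ) * q₂ * a * b) * Y - W * ((K₁ : ℝ) * K₂) =
        ((q₁ : ℝ) * q₂ * a * b) * (lam * ((X : ℝ) + Y) - Y) * (W₁ - W₂) := by
      rw [hK₁K₂, hW]; ring
    have h1 := neg_abs_add_abs_mul_le W₁ W₂ _ _ hQab0 hδ0' hδ1'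
    linarith only [e, h1]
  have hU0 : 0 ≤ β * max U 0 := mul_nonneg hβ (le_max_right _ _)
  have hD1 : W * ((L : ℝ) ^ 2 - K₁ * K₂) ≤ |W| * (((q₁ * q₂ * a + b : ℕ) : ℝ) * L) :=
    calc W * ((L : ℝ) ^ 2 - K₁ * K₂) ≤ |W| * ((L : ℝ) ^ 2 - K₁ * K₂) :=
          mul_le_mul_of_nonneg_right (le_abs_self W) hbord0
      _ ≤ |W| * (((q₁ * q₂ * a + b : ℕ) : ℝ) * L) := mul_le_mul_of_nonneg_left hborder_le (abs_nonneg W)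
  have hD2 : β * max U 0 * ((u : ℝ) + v) ≤ β * max U 0 * (((q₁ * q₂ * a + b : ℕ) : ℝ) * L) := by
    rw [hρuv]
    exact mul_le_mul_of_nonneg_left (hρle.trans hborder_le) hU0
  have hX0 : (0 : ℝ) ≤ X := Nat.cast_nonneg X
  have hY0 : (0 : ℝ) ≤ Y := Nat.cast_nonneg Y
  have hNle : ((q₁ : ℝ) * q₂ * a * b) * ((X : ℝ) + Y) ≤ (L : ℝ) ^ 2 := by rw [← hK₁K₂]; exact hK₁K₂le
  have hab1 : (1 : ℝ) ≤ (a : ℝ) * b :=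
    one_le_mul_of_one_le_of_one_le (by exact_mod_cast ha) (by exact_mod_cast hb)
  have hq0 : (0 : ℝ) ≤ (q₁ : ℝ) * q₂ := by positivity
  have hD3₁ : (S.card : ℝ) * Real.log (((Q * X : ℕ) : ℝ) + 1) ≤ S.card * Real.log ((L : ℝ) ^ 2 + 1) := by
    refine mul_le_mul_of_nonneg_left (Real.log_le_log (by positivity) ?_) (Nat.cast_nonneg _)
    push_cast; rw [hQR]
    have h1 : (q₁ : ℝ) * q₂ * X ≤ (q₁ : ℝ) * q₂ * X * (a * b) :=
      le_mul_of_one_le_right (mul_nonneg hq0 hX0) hab1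
    have h2 : (q₁ : ℝ) * q₂ * a * b * X ≤ (q₁ : ℝ) * q₂ * a * b * (X + Y) :=
      mul_le_mul_of_nonneg_left (le_add_of_nonneg_right hY0) hQab0
    linarith only [h1, h2, hNle]
  have hD3₂ : (S.card : ℝ) * Real.log (((Q * Y : ℕ) : ℝ) + 1) ≤ S.card * Real.log ((L : ℝ) ^ 2 + 1) := by
    refine mul_le_mul_of_nonneg_left (Real.log_le_log (by positivity) ?_) (Nat.cast_nonneg _)
    push_cast; rw [hQR]
    have h1 : (q₁ : ℝ) * q₂ * Y ≤ (q₁ : ℝ) * q₂ * Y * (a * b) :=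
      le_mul_of_one_le_right (mul_nonneg hq0 hY0) hab1
    have h2 : (q₁ : ℝ) * q₂ * a * b * Y ≤ (q₁ : ℝ) * q₂ * a * b * (X + Y) :=
      mul_le_mul_of_nonneg_left (le_add_of_nonneg_left hX0) hQab0
    linarith only [h1, h2, hNle]
  have key : W * (L : ℝ) ^ 2 = W * ((K₁ : ℝ) * K₂) + W * ((L : ℝ) ^ 2 - K₁ * K₂) := by ring
  have hcastQ : ((q₁ * q₂ * a * b : ℕ) : ℝ) = (q₁ : ℝ) * q₂ * a * b := by push_cast; ring
  show W * (L : ℝ) ^ 2 - (|W| + β * max U 0) * ((q₁ * q₂ * a + b : ℕ) : ℝ) * L -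
      (|W₁| + |W₂|) * ((q₁ * q₂ * a * b : ℕ) : ℝ) - 2 * S.card * Real.log ((L : ℝ) ^ 2 + 1) ≤
      Real.log (partitionFn β (sectorHamiltonianTT' t t' U n L)).re
  rw [hcastQ]
  linarith only [hlogZ, hlogc₁, hlogc₂, hWX, hWY, hchord, key, hD1, hD2, hD3₁, hD3₂]

end Chord

/-! ### §3 Thermodynamic limit along every `Ls → ∞`: the chord floor at every filling of the interval -/

section Limit
set_option maxHeartbeats 400000 in
/-- **The certified C2 floor at EVERY FILLING between two certified types, along EVERY `Ls → ∞`.** Data as in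
`typeFreeEntropy_chord_mul_sq_sub_le_log_partitionFn`: one open `a × b` box with floors `0 < z_s ≤ Re Z_β(H^open; s)`,
two balanced base types `m₁` (`q₁`, `A₁`) and `m₂` (`q₂`, `A₂`) supported in `S` with `A₁q₂ ≤ A₂q₁`, `λ ∈ [0,1]`,
density `n = (1−λ)ρ₁ + λρ₂ < 2` (`n q₁q₂ab = 2((1−λ)A₁q₂ + λA₂q₁)`). Then for every `ε > 0`, eventually along
ANY `Ls → ∞`: `((1−λ)W₁ + λW₂ − ε)(Ls j)² ≤ log Re Z_β(sectorHamiltonianTT' t t' U n (Ls j))`,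
`W_i = (q_i log q_i − Σ m_i log m_i + Σ m_i log z_s)/(q_i a b)` — the pressure-floor input `hW` of the `T > 0`
readers (`HubbardThermalAxisWindow`, `TorusSectorGibbsEntropyRowPressureInput`) at every density of `[ρ₁, ρ₂]`
from the SAME two certified types (the free energy floor is the chord; filling leg of BOX → WORD).
[cite: Ruelle1969, §3.3 (3.11)–(3.18)] [cite: Israel1979, Lemma II.3.1] [cite: CoverThomas2006, Theorem 11.1.3] -/
theorem InfVolFermionState.eventually_typeFreeEntropy_chord_mul_sq_le_log_partitionFn_allTori (t t' U n : ℝ)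
    {β : ℝ} (hβ : 0 ≤ β) {a b : ℕ} (ha : 1 ≤ a) (hb : 1 ≤ b) (S : Finset (ℕ × ℕ)) (m₁ m₂ : ℕ × ℕ → ℕ)
    {q₁ q₂ A₁ A₂ : ℕ} (hq₁ : 1 ≤ q₁) (hq₂ : 1 ≤ q₂) (hm₁S : ∀ s, m₁ s ≠ 0 → s ∈ S)
    (hm₂S : ∀ s, m₂ s ≠ 0 → s ∈ S) (hsum₁ : ∑ s ∈ S, m₁ s = q₁) (hsum₂ : ∑ s ∈ S, m₂ s = q₂)
    (hA₁ : ∑ s ∈ S, m₁ s * s.1 = A₁) (hB₁ : ∑ s ∈ S, m₁ s * s.2 = A₁)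
    (hA₂ : ∑ s ∈ S, m₂ s * s.1 = A₂) (hB₂ : ∑ s ∈ S, m₂ s * s.2 = A₂) (hρ : A₁ * q₂ ≤ A₂ * q₁)
    {lam : ℝ} (hlam0 : 0 ≤ lam) (hlam1 : lam ≤ 1)
    (hn : n * ((q₁ : ℝ) * q₂ * a * b) = 2 * ((1 - lam) * A₁ * q₂ + lam * A₂ * q₁)) (hn2 : n < 2)
    {z : ℕ × ℕ → ℝ} (hz0 : ∀ s ∈ S, 0 < z s)
    (hz : ∀ s ∈ S, z s ≤ (partitionFn β (spinSectorHamiltonian s.1 s.2 (hubbardOpenBoxTT' a b t t' U))).re)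
    {Ls : ℕ → ℕ} (hLs : Tendsto Ls atTop atTop) {ε : ℝ} (hε : 0 < ε) :
    ∀ᶠ j in atTop, ((1 - lam) * (((q₁ : ℝ) * Real.log q₁ - ∑ s ∈ S, (m₁ s : ℝ) * Real.log (m₁ s) +
          ∑ s ∈ S, (m₁ s : ℝ) * Real.log (z s)) / ((q₁ : ℝ) * a * b)) +
        lam * (((q₂ : ℝ) * Real.log q₂ - ∑ s ∈ S, (m₂ s : ℝ) * Real.log (m₂ s) +
          ∑ s ∈ S, (m₂ s : ℝ) * Real.log (z s)) / ((q₂ : ℝ) * a * b)) - ε) * (Ls j : ℝ) ^ 2 ≤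
      Real.log (partitionFn β (sectorHamiltonianTT' t t' U n (Ls j))).re := by
  set W₁ : ℝ := ((q₁ : ℝ) * Real.log q₁ - ∑ s ∈ S, (m₁ s : ℝ) * Real.log (m₁ s) +
    ∑ s ∈ S, (m₁ s : ℝ) * Real.log (z s)) / ((q₁ : ℝ) * a * b) with hW₁
  set W₂ : ℝ := ((q₂ : ℝ) * Real.log q₂ - ∑ s ∈ S, (m₂ s : ℝ) * Real.log (m₂ s) +
    ∑ s ∈ S, (m₂ s : ℝ) * Real.log (z s)) / ((q₂ : ℝ) * a * b) with hW₂
  set W : ℝ := (1 - lam) * W₁ + lam * W₂ with hW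
  -- the `2|S| log(L² + 1)` term is `≤ (ε/2) L²` eventually (`log x = o(x)`)
  have hε2 : 0 < ε / 2 := by linarith
  have hev : ∀ᶠ j in atTop, 2 * (S.card : ℝ) * Real.log ((Ls j : ℝ) ^ 2 + 1) ≤ ε / 2 * (Ls j : ℝ) ^ 2 := by
    have h2 : Tendsto (fun j => (Ls j : ℝ) ^ 2 + 1) atTop atTop := tendsto_atTop_add_const_right _ 1
      ((tendsto_pow_atTop two_ne_zero).comp (tendsto_natCast_atTop_atTop.comp hLs))
    set c : ℝ := (ε / 2) / (4 * S.card + 1) with hc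
    have hcpos : 0 < c := by positivity
    have h3 := h2.eventually (Real.isLittleO_log_id_atTop.def hcpos)
    filter_upwards [h3, hLs.eventually_ge_atTop 1] with j hj hj1
    have hL1 : (1 : ℝ) ≤ (Ls j : ℝ) ^ 2 := by nlinarith [show (1 : ℝ) ≤ Ls j by exact_mod_cast hj1]
    have hpos : 0 < (Ls j : ℝ) ^ 2 + 1 := by positivity
    have hlogle : Real.log ((Ls j : ℝ) ^ 2 + 1) ≤ c * ((Ls j : ℝ) ^ 2 + 1) := by
      rwa [id, Real.norm_eq_abs, Real.norm_eq_abs, abs_of_nonneg (Real.log_nonneg (by linarith)),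
        abs_of_pos hpos] at hj
    have hS : (0 : ℝ) ≤ 2 * S.card := by positivity
    have h5 : 2 * (S.card : ℝ) * ((Ls j : ℝ) ^ 2 + 1) ≤ (4 * S.card + 1) * (Ls j : ℝ) ^ 2 := by nlinarith
    calc 2 * (S.card : ℝ) * Real.log ((Ls j : ℝ) ^ 2 + 1) ≤ 2 * S.card * (c * ((Ls j : ℝ) ^ 2 + 1)) :=
          mul_le_mul_of_nonneg_left hlogle hS
      _ = c * (2 * (S.card : ℝ) * ((Ls j : ℝ) ^ 2 + 1)) := by ring
      _ ≤ c * ((4 * S.card + 1) * (Ls j : ℝ) ^ 2) := mul_le_mul_of_nonneg_left h5 hcpos.le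
      _ = ε / 2 * (Ls j : ℝ) ^ 2 := by
          rw [hc]
          field_simp
  -- the linear and constant terms are `≤ (ε/2) L²` for `L ≥ 2 (C + D)/ε`, `L ≥ 1`
  set C : ℝ := (|W| + β * max U 0) * ((q₁ * q₂ * a + b : ℕ) : ℝ) with hC
  set D : ℝ := (|W₁| + |W₂|) * ((q₁ * q₂ * a * b : ℕ) : ℝ) with hD
  have hC0 : 0 ≤ C := by
    have : 0 ≤ β * max U 0 := mul_nonneg hβ (le_max_right _ _)
    positivity
  have hD0 : 0 ≤ D := by positivity
  -- the surplus condition `A₂q₁ − A₁q₂ ≤ (1 − n/2) L`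
  have hn2' : 0 < 1 - n / 2 := by linarith
  filter_upwards [hev, hLs.eventually_ge_atTop (max (q₁ * q₂ * a + 1) (max (b + 1)
    (max ⌈2 * (C + D) / ε⌉₊ ⌈((A₂ * q₁ - A₁ * q₂ : ℕ) : ℝ) / (1 - n / 2)⌉₊)))] with j hjε hj
  have hLa : q₁ * q₂ * a + 1 ≤ Ls j := le_trans (le_max_left _ _) hj
  have hLb : b + 1 ≤ Ls j := le_trans ((le_max_left _ _).trans (le_max_right _ _)) hj
  have hLc : (⌈2 * (C + D) / ε⌉₊ : ℝ) ≤ Ls j := by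
    exact_mod_cast le_trans (((le_max_left _ _).trans (le_max_right _ _)).trans (le_max_right _ _)) hj
  have hLd : (⌈((A₂ * q₁ - A₁ * q₂ : ℕ) : ℝ) / (1 - n / 2)⌉₊ : ℝ) ≤ Ls j := by
    exact_mod_cast le_trans (((le_max_right _ _).trans (le_max_right _ _)).trans (le_max_right _ _)) hj
  have hLC : 2 * (C + D) / ε ≤ Ls j := le_trans (Nat.le_ceil _) hLc
  rw [div_le_iff₀ hε] at hLC
  have hLn : ((A₂ * q₁ - A₁ * q₂ : ℕ) : ℝ) ≤ (1 - n / 2) * (Ls j : ℝ) := by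
    have h1 : ((A₂ * q₁ - A₁ * q₂ : ℕ) : ℝ) / (1 - n / 2) ≤ Ls j := le_trans (Nat.le_ceil _) hLd
    rw [div_le_iff₀ hn2'] at h1
    linarith
  have hfin := typeFreeEntropy_chord_mul_sq_sub_le_log_partitionFn t t' U n hβ ha hb S m₁ m₂ hq₁ hq₂ hm₁S hm₂S
    hsum₁ hsum₂ hA₁ hB₁ hA₂ hB₂ hρ hlam0 hlam1 hn hn2 hz0 hz hLa hLb hLn
  have hL1 : (1 : ℝ) ≤ Ls j := by exact_mod_cast le_trans (Nat.le_add_left 1 b) hLb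
  have hL0 : (0 : ℝ) ≤ Ls j := by linarith
  have hlin : C * (Ls j : ℝ) + D ≤ ε / 2 * (Ls j : ℝ) ^ 2 := by
    have h1 : D ≤ D * (Ls j : ℝ) := le_mul_of_one_le_right hD0 hL1
    nlinarith
  have e : (W - ε) * (Ls j : ℝ) ^ 2 = W * (Ls j : ℝ) ^ 2 - ε / 2 * (Ls j : ℝ) ^ 2 - ε / 2 * (Ls j : ℝ) ^ 2 := by ring
  rw [e]
  have hfin' : W * (Ls j : ℝ) ^ 2 - C * (Ls j : ℝ) - D - 2 * S.card * Real.log ((Ls j : ℝ) ^ 2 + 1) ≤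
      Real.log (partitionFn β (sectorHamiltonianTT' t t' U n (Ls j))).re := by
    have := hfin; rw [hC, hD]; linarith [this]
  linarith [hfin', hlin, hjε]

end Limit

end Literature.MathematicalPhysics.QuantumLattice

end
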